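import Summits.Schanuel.Schanuel.Theorems.DiophantineDichotomyApproximationPropertyElimCISpaceLemmas
import Summits.Schanuel.Schanuel.Theorems.DiophantineDichotomyApproximationPropertyCIInterpolation
import HarnessLib

/-!
# Complete intersections of dimension zero in `ℙ³`, II: the graded decomposition and the
# interpolation clause (crux `stmt-Schanuel-6117`, line `orbit-interpolation-determinant`, stub `elim_ciSpace`)

Crux `stmt-Schanuel-6117` (`Summit.Schanuel.Schanuel.Theses.DiophantineDichotomy.ApproximationProperty`),
route `DiophantineDichotomy`, line `orbit-interpolation-determinant`. This file PROVES the registered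
stub `elim_ciSpace` (the `ℙ³` analogue, one hypersurface section further, of the landed plane stubs
`stub_ciDecomposition` / `stub_ciInterpolation`). Everything here is PROVED; no definitions, no named
facts.

Let `S = ℚ[x₀, …, x₃]` (`Rx 3`), `Q ≠ 0` a form of degree `a ≥ 1` generating a prime ideal,
`P ∉ (Q)` a form of degree `b ≥ 1`, `T` a form of degree `τ ≥ 1` which is a non-zero-divisor modulo
`(Q, P)`.

* (I) **Graded decomposition.** For every finite family `𝓕` of ideals each missing some linear form
  there is a linear form `L ≠ 0` outside every member of `𝓕`, a non-zero-divisor modulo `(Q, P, T)`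
  (landed: `ElimCISpace.exists_linearForm`, Macaulay's unmixedness + prime avoidance in `S₁`), with
  `S_{s+N} = L^N S_s + (Q, P, T)_{s+N}` for all `s ≥ a + b + τ` and all `N`:
  `ElimCISpace.idealDegree_sup_span_eq` (`(Q, P, T, L)_{s+1} = S_{s+1}` for `s ≥ a + b + τ`, four
  applications of the hypersurface-section formula `finrank_idealDegree_sup_span_add_eq` for the
  regular sequence `Q, P, T, L` and the arithmetic `ElimCISpace.hilbert_arith`), then
  `ElimCISpace.decomp`.
* (II) **Interpolation clause.** Every homogeneous prime `𝔮` of rank `1` (a Galois orbit of points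
  of `ℙ³`) whose zeros lie on `V(Q) ∩ V(P) ∩ V(T)` imposes independent conditions on the forms of
  every degree `s ≥ a + b + τ`: `dim S_s = dim 𝔮_s + deg 𝔮`. With a normalised zero `b̄'` of `𝔮`
  (`stub_zeroDimDictionary_zeros`), `K = ℚ(b̄')` and (I), this is the landed general-`m` lemma
  `CIInterpolation.finrank_eq` (the evaluation map `S_s → K` is onto with kernel `𝔮_s`, and
  `[K:ℚ] = deg 𝔮`): `ElimCISpace.finrank_eq_of_decomp`.

Sources: Nesterenko–Philippon (eds.), LNM 1752, Ch. 3 §5 (p. 42), Ch. 10 §3 (Macaulay) and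
Ch. 11 §2.2 (Hilbert functions of hypersurface sections); Philippon, Bull. SMF 114 (1986),
Lemme 3.1 and §1.
-/

set_option linter.dupNamespace false

noncomputable section

namespace Summit.Schanuel.Schanuel.Cruxes.ApproximationProperty.OrbitInterpolationDeterminant

open Literature.NumberTheory.Transcendental.Nesterenko MvPolynomial Module
open Literature.RingTheory.MvPolynomial

namespace ElimCISpace

/-! ## (I) `(Q, P, T, L)_{s+1} = S_{s+1}` for `s ≥ a + b + τ` -/

section Space

variable {Q P T : Rx 3} {a b τ : ℕ}

/-- A non-zero-divisor modulo the proper ideal `(Q, P)` (`Q`, `P` forms of positive degree) is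
non-zero. [folklore] -/
theorem ne_zero_of_nzd (hQ : Q.IsHomogeneous a) (hP : P.IsHomogeneous b) (ha : 1 ≤ a) (hb : 1 ≤ b)
    (hT : ∀ f, T * f ∈ Ideal.span {Q} ⊔ Ideal.span {P} → f ∈ Ideal.span {Q} ⊔ Ideal.span {P}) :
    T ≠ 0 := by
  rintro rfl
  have h1 : (1 : Rx 3) ∈ Ideal.span {Q} ⊔ Ideal.span {P} :=
    hT 1 (by rw [zero_mul]; exact zero_mem _)
  have hle : Ideal.span {Q} ⊔ Ideal.span {P} ≤ RingHom.ker (constantCoeff : Rx 3 →+* ℚ) :=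
    sup_le ((Ideal.span_singleton_le_iff_mem _).mpr (mem_ker_constantCoeff_of_isHomogeneous hQ ha))
      ((Ideal.span_singleton_le_iff_mem _).mpr (mem_ker_constantCoeff_of_isHomogeneous hP hb))
  have := hle h1
  rw [RingHom.mem_ker, map_one] at this
  exact one_ne_zero this

/-- **`(Q, P, T, L)_{s+1} = S_{s+1}` for `s ≥ a + b + τ`** when `L` is a linear non-zero-divisor
modulo `(Q, P, T)` (four applications of the hypersurface-section formula, for the regular sequence
`Q, P, T, L`). [cite: Philippon1986, Lemme 3.1] -/
theorem idealDegree_sup_span_eq (hQ0 : Q ≠ 0) (hQ : Q.IsHomogeneous a) (hP : P.IsHomogeneous b)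
    (hTτ : T.IsHomogeneous τ) (ha : 1 ≤ a) (hb : 1 ≤ b)
    (hprime : (Ideal.span {Q}).IsPrime) (hPQ : P ∉ Ideal.span {Q})
    (hT : ∀ f, T * f ∈ Ideal.span {Q} ⊔ Ideal.span {P} → f ∈ Ideal.span {Q} ⊔ Ideal.span {P})
    {L : Rx 3} (hL1 : L.IsHomogeneous 1) (hL0 : L ≠ 0)
    (hnzd : ∀ f, L * f ∈ Ideal.span {Q} ⊔ Ideal.span {P} ⊔ Ideal.span {T} →
      f ∈ Ideal.span {Q} ⊔ Ideal.span {P} ⊔ Ideal.span {T})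
    {s : ℕ} (hs : a + b + τ ≤ s) :
    idealDegree (Ideal.span {Q} ⊔ Ideal.span {P} ⊔ Ideal.span {T} ⊔ Ideal.span {L}) (s + 1) =
      homogeneousSubmodule (Fin (3 + 1)) ℚ (s + 1) := by
  letI : GradedAlgebra (homogeneousSubmodule (Fin (3 + 1)) ℚ) := MvPolynomial.gradedAlgebra
  have hQhom : (Ideal.span {Q}).IsHomogeneous (homogeneousSubmodule (Fin (3 + 1)) ℚ) :=
    isHomogeneous_span hQ
  have hJ₂ : (Ideal.span {Q} ⊔ Ideal.span {P}).IsHomogeneous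
      (homogeneousSubmodule (Fin (3 + 1)) ℚ) :=
    hQhom.sup (isHomogeneous_span hP)
  have hJ₃ : (Ideal.span {Q} ⊔ Ideal.span {P} ⊔ Ideal.span {T}).IsHomogeneous
      (homogeneousSubmodule (Fin (3 + 1)) ℚ) :=
    hJ₂.sup (isHomogeneous_span hTτ)
  have hP0 : P ≠ 0 := by
    rintro rfl
    exact hPQ (Ideal.zero_mem _)
  have hT0 : T ≠ 0 := ne_zero_of_nzd hQ hP ha hb hT
  have hnzdQ : ∀ f, Q * f ∈ (⊥ : Ideal (Rx 3)) → f ∈ (⊥ : Ideal (Rx 3)) := fun f hf => by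
    rw [Ideal.mem_bot] at hf ⊢
    exact (mul_eq_zero.mp hf).resolve_left hQ0
  have hnzdP : ∀ f, P * f ∈ Ideal.span {Q} → f ∈ Ideal.span {Q} := fun f hf =>
    (hprime.mem_or_mem hf).resolve_left hPQ
  have hq : ∀ t n, n = t + a → finrank ℚ (idealDegree (Ideal.span {Q}) n) =
      finrank ℚ (homogeneousSubmodule (Fin (3 + 1)) ℚ t) := by
    rintro t n rfl
    have h := finrank_idealDegree_sup_span_add_eq (Ideal.IsHomogeneous.bot _) hQ0 hQ hnzdQ t
    rw [bot_sup_eq, idealDegree_bot, idealDegree_bot, finrank_bot] at h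
    simpa using h
  have hj : ∀ t n, n = t + b →
      finrank ℚ (idealDegree (Ideal.span {Q} ⊔ Ideal.span {P}) n) +
        finrank ℚ (idealDegree (Ideal.span {Q}) t) =
      finrank ℚ (idealDegree (Ideal.span {Q}) n) +
        finrank ℚ (homogeneousSubmodule (Fin (3 + 1)) ℚ t) := by
    rintro t n rfl
    exact finrank_idealDegree_sup_span_add_eq hQhom hP0 hP hnzdP t
  have hk : ∀ t n, n = t + τ →
      finrank ℚ (idealDegree (Ideal.span {Q} ⊔ Ideal.span {P} ⊔ Ideal.span {T}) n) +
        finrank ℚ (idealDegree (Ideal.span {Q} ⊔ Ideal.span {P}) t) =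
      finrank ℚ (idealDegree (Ideal.span {Q} ⊔ Ideal.span {P}) n) +
        finrank ℚ (homogeneousSubmodule (Fin (3 + 1)) ℚ t) := by
    rintro t n rfl
    exact finrank_idealDegree_sup_span_add_eq hJ₂ hT0 hTτ hT t
  have hkl := finrank_idealDegree_sup_span_add_eq hJ₃ hL0 hL1 hnzd s
  have hfin := hilbert_arith
    (kl := fun n => finrank ℚ
      (idealDegree (Ideal.span {Q} ⊔ Ideal.span {P} ⊔ Ideal.span {T} ⊔ Ideal.span {L}) n))
    hs finrank_homogeneousSubmodule_succ hq hj hk hkl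
  haveI := finite_homogeneousSubmodule (K := ℚ) (σ := Fin (3 + 1)) (s + 1)
  exact Submodule.eq_of_le_of_finrank_eq (idealDegree_le_homogeneousSubmodule _ _) hfin

/-- **(I) The graded decomposition above the regularity.** Under the hypotheses of
`elim_ciSpace`, for every finite family `𝓕` of ideals each missing some linear form there is a
linear form `L ≠ 0` outside every member of `𝓕`, a non-zero-divisor modulo `(Q, P, T)`, with
`S_{s+N} = L^N S_s + (Q, P, T)_{s+N}` for all `s ≥ a + b + τ` and all `N`.
[cite: NesterenkoPhilippon2001, Ch. 10 §3 (proof of Prop. 3.6) and Ch. 11 §2.2] -/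
theorem decomposition (hQ0 : Q ≠ 0) (hQ : Q.IsHomogeneous a) (hP : P.IsHomogeneous b)
    (hTτ : T.IsHomogeneous τ) (ha : 1 ≤ a) (hb : 1 ≤ b) (hτ : 1 ≤ τ)
    (hprime : (Ideal.span {Q}).IsPrime) (hPQ : P ∉ Ideal.span {Q})
    (hT : ∀ f, T * f ∈ Ideal.span {Q} ⊔ Ideal.span {P} → f ∈ Ideal.span {Q} ⊔ Ideal.span {P})
    (𝓕 : Finset (Ideal (Rx 3))) (h𝓕 : ∀ 𝔮 ∈ 𝓕, ∃ L : Rx 3, L.IsHomogeneous 1 ∧ L ∉ 𝔮) :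
    ∃ L : Rx 3, L.IsHomogeneous 1 ∧ (∀ 𝔮 ∈ 𝓕, L ∉ 𝔮) ∧ L ≠ 0 ∧
      (∀ f, L * f ∈ Ideal.span {Q} ⊔ Ideal.span {P} ⊔ Ideal.span {T} →
        f ∈ Ideal.span {Q} ⊔ Ideal.span {P} ⊔ Ideal.span {T}) ∧
      ∀ (s N : ℕ) (F : Rx 3), a + b + τ ≤ s → F.IsHomogeneous (s + N) →
        ∃ G : Rx 3, G.IsHomogeneous s ∧
          F - L ^ N * G ∈ Ideal.span {Q} ⊔ Ideal.span {P} ⊔ Ideal.span {T} := by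
  obtain ⟨L, hL1, hL𝓕, hL0, hnzd⟩ :=
    exists_linearForm hQ0 hQ hP hTτ ha hb hτ hprime hPQ hT 𝓕 h𝓕
  refine ⟨L, hL1, hL𝓕, hL0, hnzd, fun s N F hs hF => ?_⟩
  exact decomp hQ hP hTτ hL1
    (fun n hn => idealDegree_sup_span_eq hQ0 hQ hP hTτ ha hb hprime hPQ hT hL1 hL0 hnzd
      (hs.trans hn)) N F hF

end Space

/-! ## (II) The interpolation clause from the decomposition -/

variable {m : ℕ}

/-- **(II) Interpolation from a decomposition.** Let `𝔮 ⊂ ℚ[x₀, …, x_m]` be a homogeneous prime of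
rank `1` whose zeros are zeros of an ideal `J`, and suppose every form of degree `s + N` is
`L^N G + (J)_{s+N}` with `G` a form of degree `s` (all `N`). Then the zeros of `𝔮` impose independent
conditions on the forms of degree `s`: `dim ℚ[x̲]_s = dim 𝔮_s + deg 𝔮` (the evaluation map
`ℚ[x̲]_s → K = ℚ(b̄')` at a normalised zero is onto with kernel `𝔮_s`, `[K:ℚ] = deg 𝔮`).
[cite: NesterenkoPhilippon2001, Ch. 3 §5 (p. 42); Philippon1986Criteres, §1] -/
theorem finrank_eq_of_decomp {J 𝔮 : Ideal (Rx m)} (h𝔮 : 𝔮.IsPrime)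
    (hhomc : ∀ F ∈ 𝔮, ∀ k : ℕ, homogeneousComponent k F ∈ 𝔮) (hunm : IsUnmixedOfRank 𝔮 1)
    (hsub : projZeros 𝔮 ⊆ projZeros J) {L : Rx m} {s : ℕ}
    (hdec : ∀ (N : ℕ) (F : Rx m), F.IsHomogeneous (s + N) →
      ∃ G : Rx m, G.IsHomogeneous s ∧ F - L ^ N * G ∈ J) :
    Module.finrank ℚ ↥(homogeneousSubmodule (Fin (m + 1)) ℚ s) =
      Module.finrank ℚ ↥(homogeneousSubmodule (Fin (m + 1)) ℚ s ⊓ 𝔮.restrictScalars ℚ) +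
        ideg 𝔮 1 := by
  letI : GradedAlgebra (homogeneousSubmodule (Fin (m + 1)) ℚ) := MvPolynomial.gradedAlgebra
  -- `𝔮` is a homogeneous ideal for Mathlib's grading
  have hhom : 𝔮.IsHomogeneous (homogeneousSubmodule (Fin (m + 1)) ℚ) := by
    intro i F hF
    have e : (DirectSum.decompose (homogeneousSubmodule (Fin (m + 1)) ℚ) F i : Rx m) =
        homogeneousComponent i F :=
      MvPolynomial.decomposition.decompose'_apply F i
    rw [e]
    exact hhomc F hF i
  -- a normalised zero `b̄'` of `𝔮`, `b'_j = 1`, and its field `K = ℚ(b̄')`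
  obtain ⟨b', hb', j, hj, -⟩ := stub_zeroDimDictionary_zeros m 𝔮 h𝔮 hhom hunm
  haveI := numberField_adjoin h𝔮 hhom hunm hb' hj
  let bK : Fin (m + 1) → ↥(IntermediateField.adjoin ℚ (Set.range b')) := fun k =>
    ⟨b' k, IntermediateField.subset_adjoin ℚ _ ⟨k, rfl⟩⟩
  have hbK : ∀ k, (bK k : ℂ) = b' k := fun k => rfl
  -- `J` vanishes at `b̄`
  have hJ : ∀ F ∈ J, aeval bK F = 0 := fun F hF =>
    Subtype.ext (by rw [coe_aeval_eq hbK, (hsub hb').2 F hF]; rfl)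
  exact CIInterpolation.finrank_eq h𝔮 hhom hunm hb' hj hbK hJ hdec

end ElimCISpace

/-- **Complete intersections of dimension `0` in `ℙ³`, II** (crux `stmt-Schanuel-6117`, line
`orbit-interpolation-determinant`, registered stub `elim_ciSpace`). Let `Q ≠ 0` be a form of degree
`a ≥ 1` of `S = ℚ[x₀, …, x₃]` generating a prime ideal, `P ∉ (Q)` a form of degree `b ≥ 1`, `T` a
form of degree `τ ≥ 1` which is a non-zero-divisor modulo `(Q, P)`. Then (I) for every finite family
of ideals each missing a linear form there is a linear form `L ≠ 0` outside all of them, a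
non-zero-divisor modulo `(Q, P, T)`, with `S_{s+N} = L^N S_s + (Q, P, T)_{s+N}` for all
`s ≥ a + b + τ` and all `N`; (II) every homogeneous prime `𝔮` of rank `1` whose zeros lie on
`V(Q) ∩ V(P) ∩ V(T)` imposes independent conditions on the forms of every degree `s ≥ a + b + τ`:
`dim S_s = dim 𝔮_s + deg 𝔮`.
[cite: NesterenkoPhilippon2001, Ch. 3 §5 (p. 42), Ch. 10 §3 (proof of Prop. 3.6), Ch. 11 §2.2] -/
theorem elim_ciSpace : ∀ (Q P T : Rx 3) (a b τ : ℕ), Q ≠ 0 → Q.IsHomogeneous a → P.IsHomogeneous b → T.IsHomogeneous τ → 1 ≤ a → 1 ≤ b → 1 ≤ τ → (Ideal.span {Q}).IsPrime → P ∉ Ideal.span {Q} → (∀ f, T * f ∈ Ideal.span {Q} ⊔ Ideal.span {P} → f ∈ Ideal.span {Q} ⊔ Ideal.span {P}) → (∀ 𝓕 : Finset (Ideal (Rx 3)), (∀ 𝔮 ∈ 𝓕, ∃ L : Rx 3, L.IsHomogeneous 1 ∧ L ∉ 𝔮) → ∃ L : Rx 3, L.IsHomogeneous 1 ∧ (∀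 𝔮 ∈ 𝓕, L ∉ 𝔮) ∧ L ≠ 0 ∧ (∀ f, L * f ∈ Ideal.span {Q} ⊔ Ideal.span {P} ⊔ Ideal.span {T} → f ∈ Ideal.span {Q} ⊔ Ideal.span {P} ⊔ Ideal.span {T}) ∧ ∀ (s N : ℕ) (F : Rx 3), a + b + τ ≤ s → F.IsHomogeneous (s + N) → ∃ G : Rx 3, G.IsHomogeneous s ∧ F - L ^ N * G ∈ Ideal.span {Q} ⊔ Ideal.span {P} ⊔ Ideal.span {T}) ∧ (∀ 𝔮 : Ideal (Rx 3), 𝔮.IsPrime → (∀ F ∈ 𝔮, ∀ k : ℕ, homogeneousComponent k F ∈ 𝔮) → IsUnmixedOfRank 𝔮 1 → projZeros 𝔮 ⊆ projZeros (Ideal.span {Q} ⊔ Ideal.span {P} ⊔ Ideal.span {T}) → ∀ s : ℕ, a + b + τ ≤ s → Module.finrank ℚ ↥(homogeneousSubmodule (Fin (3 + 1)) ℚ s) = Module.finrank ℚ ↥(homogeneousSubmodule (Fin (3 + 1)) ℚ s ⊓ 𝔮.restrictScalars ℚ) + ideg 𝔮 1) := by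
  intro Q P T a b τ hQ0 hQ hP hTτ ha hb hτ hprime hPQ hT
  refine ⟨fun 𝓕 h𝓕 => ElimCISpace.decomposition hQ0 hQ hP hTτ ha hb hτ hprime hPQ hT 𝓕 h𝓕,
    fun 𝔮 h𝔮 hhomc hunm hsub s hs => ?_⟩
  obtain ⟨L, -, -, -, -, hdec⟩ :=
    ElimCISpace.decomposition hQ0 hQ hP hTτ ha hb hτ hprime hPQ hT ∅ (by simp)
  exact ElimCISpace.finrank_eq_of_decomp h𝔮 hhomc hunm hsub fun N F hF => hdec s N F hs hF

end Summit.Schanuel.Schanuel.Cruxes.ApproximationProperty.OrbitInterpolationDeterminant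

end
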